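import Summits.Parity.BatemanHorn.Theses.IsogenyRedei

/-!
# `SplitBlockJacobiCorner` (crux stmt-Parity-15002): the sign-coherent forced-square family

Negative-side structure lemma (cdisprove seat refuter-cdisprove-stmt-Parity-15002-0, cycle 1), sorry-free and without
new definitions: every pair of the corner sum with `Q' − Q = 4s²` contributes `(Q|Q') = +1`
(`jacobiSym_eq_one_of_eq_add_four_mul_sq`; by reciprocity `(Q|Q') = (Q'|Q) = (4s²|Q) = 1`), and the hypotheses are met
on the crux's pairs (`jacobiSym_eq_one_of_dvd_sq_add_one`: odd prime factors `Q < Q'` of `t² + 1` are `≡ 1 (mod 4)`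
and `Q ∤ s`).  WHY IT IS FILED: this family refutes the natural strengthening "`J^c_{θ,μ}(x) = O(√x)` /
square-root cancellation of the corner" — it is a DETERMINISTIC positive term; measured by the seat (exp/corner.c on
the item): in the cell `(θ, 2−μ) = (1/2, 1.2)` it has `980, 5062, 25774` members at `x = 10⁶, 10⁷, 10⁸`
(`≍ x^{1−θ/2}/log x`, matching the independent-roots prediction `Σ_{prime pairs, Q'−Q = 4□} 4x/(QQ') = 1032, 5079,
25565` to 1–2 %), and in the tip `2 − μ ≤ 1.02` at `x = 10⁷` it is the WHOLE bias (271 of 3763 triples, total sum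
+241).  It is `o(x)`, so it does not touch the crux; it tells the prover that the corner's true size is
`x^{1−θ/2+o(1)} ≫ √x` and that this part sits in the EXPECTED part `E^c` (prime-pair structure), not in the root
discrepancy.  The sister crux's workfile (`Cruxes/SplitBlockJacobi/Disproof.lean`, `jacobiSym_add_four_mul_sq`) has the
`(Q + 4s² | Q) = 1` form; this is the `(Q | Q')`-oriented statement the corner sum literally uses, landed.
-/

namespace Summit.Parity.BatemanHorn.Theorems.SplitBlockJacobiCorner.Negative

/-- **Forced squares.** If `Q ≡ 1 (mod 4)` and `Q' = Q + 4s²` with `gcd(2s, Q) = 1`, then `(Q | Q') = +1`: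
`(Q|Q') = (Q'|Q)` (reciprocity, `Q ≡ 1 (4)`, `Q'` odd) `= (Q' mod Q | Q) = ((2s)² | Q) = 1`. [folklore] -/
theorem jacobiSym_eq_one_of_eq_add_four_mul_sq {Q Q' s : ℕ} (hQ : Q % 4 = 1) (hQ' : Q' = Q + 4 * s ^ 2)
    (hs : Nat.Coprime (2 * s) Q) : jacobiSym (Q : ℤ) Q' = 1 := by
  subst hQ'
  have hodd : Odd (Q + 4 * s ^ 2) := by
    have hQodd : Odd Q := Nat.odd_iff.mpr (by omega)
    rcases hQodd with ⟨k, hk⟩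
    exact ⟨k + 2 * s ^ 2, by omega⟩
  rw [jacobiSym.quadratic_reciprocity_one_mod_four hQ hodd, jacobiSym.mod_left]
  have hmod : ((Q + 4 * s ^ 2 : ℕ) : ℤ) % (Q : ℤ) = (((2 * s : ℕ) : ℤ) ^ 2) % (Q : ℤ) := by
    push_cast
    have : (Q : ℤ) + 4 * (s : ℤ) ^ 2 = (2 * (s : ℤ)) ^ 2 + (Q : ℤ) * 1 := by ring
    rw [this, Int.add_mul_emod_self_left]
  rw [hmod, ← jacobiSym.mod_left]
  apply jacobiSym.sq_one'
  rw [Int.gcd_natCast_natCast]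
  exact hs

/-- An odd prime factor of `t² + 1` is `≡ 1 (mod 4)` (first supplement: `−1` is a square mod `Q`). [folklore] -/
theorem mod_four_eq_one_of_prime_dvd_sq_add_one {t Q : ℕ} (hQ : Q.Prime) (hQ2 : Q ≠ 2) (hdvd : Q ∣ t ^ 2 + 1) :
    Q % 4 = 1 := by
  haveI := Fact.mk hQ
  have hsq : IsSquare (-1 : ZMod Q) := by
    refine ⟨(t : ZMod Q), ?_⟩
    have h0 : ((t ^ 2 + 1 : ℕ) : ZMod Q) = 0 := (ZMod.natCast_eq_zero_iff _ _).mpr hdvd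
    push_cast at h0
    linear_combination -h0
  have h := ZMod.exists_sq_eq_neg_one_iff.mp hsq
  rcases Nat.Prime.eq_two_or_odd hQ with h2 | hodd
  · exact absurd h2 hQ2
  · omega

/-- **The family inside the crux's sum.** If `Q < Q'` are prime factors of `t² + 1` with `2 < Q` and
`Q' = Q + 4s²`, then the crux's summand is `(Q | Q') = +1`.  (`Q ∤ s`: otherwise `Q ∣ Q'`, impossible for distinct
primes; `Q` odd; so `gcd(2s, Q) = 1`.)  In the corner `x^θ < Q` with `θ > 1/2` gives `2 < Q` once `x ≥ 4`. [folklore] -/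
theorem jacobiSym_eq_one_of_dvd_sq_add_one {t Q Q' s : ℕ} (hQ : Q ∈ (t ^ 2 + 1).primeFactors)
    (hQ' : Q' ∈ (t ^ 2 + 1).primeFactors) (h2 : 2 < Q) (hlt : Q < Q') (hs : Q' = Q + 4 * s ^ 2) :
    jacobiSym (Q : ℤ) Q' = 1 := by
  have hQp : Q.Prime := Nat.prime_of_mem_primeFactors hQ
  have hQ'p : Q'.Prime := Nat.prime_of_mem_primeFactors hQ'
  have hQ4 : Q % 4 = 1 :=
    mod_four_eq_one_of_prime_dvd_sq_add_one hQp (by omega) (Nat.dvd_of_mem_primeFactors hQ)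
  refine jacobiSym_eq_one_of_eq_add_four_mul_sq hQ4 hs ?_
  -- gcd(2s, Q) = 1: Q is an odd prime not dividing s
  have hQodd : ¬ Q ∣ 2 := fun h => by
    have := Nat.le_of_dvd two_pos h
    omega
  have hQs : ¬ Q ∣ s := by
    intro h
    have hdvd : Q ∣ Q' := by
      rw [hs]
      exact dvd_add dvd_rfl (dvd_mul_of_dvd_right (dvd_pow h two_ne_zero) 4)
    have := (Nat.prime_dvd_prime_iff_eq hQp hQ'p).mp hdvd
    omega
  have hcop : Nat.Coprime Q (2 * s) :=
    (Nat.Prime.coprime_iff_not_dvd hQp).mpr (fun h => (Nat.Prime.dvd_mul hQp).mp h |>.elim hQodd hQs)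
  exact hcop.symm

end Summit.Parity.BatemanHorn.Theorems.SplitBlockJacobiCorner.Negative
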